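import Summits.Schanuel.Schanuel.Theses.RoyCriterion
import Literature.NumberTheory.Transcendental.RoyCriterionProp2Proofs
import Summits.Schanuel.Schanuel.Theorems.RoyCriterionRankOne
import Summits.Schanuel.Schanuel.Theorems.RoySmallValueDirichletGap.Negative.TauLtOneAndCountLeDegreeFalse

/-!
# Disproof of `RoyThesis` (crux `stmt-Schanuel-0078`, item name `roy_thesis`) — standing adversary file

Crux (route `RoyCriterion`, decl `Summit.Schanuel.Schanuel.Theses.RoyCriterion.RoyThesis`, rfl-twin of
`RoyThesisTyped` = `stmt-Schanuel-0463`, also wanted by route `PowerMapCalibration` as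
`RoyConjectureTwo`): `∀ n, RoyCriterion n` — Roy's Conjecture 2 (Acta Arith. 97 (2001) 183–194, §1)
for every rank: for `y₁,…,yₙ ∈ ℂ` linearly independent over `ℚ`, `α₁,…,αₙ ∈ ℂˣ` and parameters in
the window (1) `max(1,t₀,2t₁) < min(s₀,2s₁)`, `max(s₀,s₁+t₁) < u < (1+t₀+t₁)/2`, the small-value
hypothesis (for all large `N` a non-zero `P_N ∈ ℤ[X₀,X₁]`, `deg_{X₀} ≤ N^{t₀}`, `deg_{X₁} ≤ N^{t₁}`,
height `≤ e^N`, `|D^k P_N(Σ mⱼyⱼ, Π αⱼ^{mⱼ})| ≤ e^{−N^u}` for `k ≤ N^{s₀}`, `mⱼ ≤ N^{s₁}`,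
`D = ∂₀ + X₁∂₁`) forces `trdeg_ℚ ℚ(y, α) ≥ n`.

## Findings (everything in this file is sorry-free; `lean check` rc 0)

* §0 RESISTANCE CERTIFICATE. `crux_iff_schanuel : RoyThesis ↔ Schanuel` — Roy's equivalence is a
  THEOREM in tree (`Roy2001_iff_holds`, kernel-checked, standard axioms), and `Schanuel` unfolds to
  `∀ l, SchanuelRank l`. So `¬ RoyThesis ↔ ¬ Schanuel` (`not_crux_iff_not_schanuel`): a kill of this
  crux IS a counterexample to Schanuel's conjecture. Ranks `0` and `1` are theorems
  (`royCriterion_zero`; `royCriterion_one` = Hermite–Lindemann through Roy's Thm 1), so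
  `crux_iff_forall_two_le` and `not_crux_iff_exists_counterexample`: the crux fails iff some
  `ℚ`-linearly independent `y ∈ ℂⁿ`, `n ≥ 2`, has `trdeg ℚ(y, e^y) < n` (e.g. an algebraic relation
  between `e` and `π`, `y = (1, iπ)`). None is known; no finite computation bears on it.
* §1 LOAD-BEARING HYPOTHESES (`crux_false_without_…`, each with an explicit kernel-checked witness):
  - `LinearIndependent ℚ y`: FALSE without it at EVERY rank `n ≥ 1` and EVERY admissible tuple
    (`withoutLinearIndependent_fails_everywhere`): `y = 0`, `α = 1 = e^0`, hypothesis by the in-tree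
    Thue–Siegel auxiliary polynomial `royHypothesis_exp'`, `trdeg ℚ(0, 1) = 0`.
  - `α_j ≠ 0`: FALSE without it (`crux_false_without_units`): `(y, α) = (1, 0)`, Roy's example
    parameters `(1.3, 0.7, 1.2, 0.5, 1.32)`, `P_N = X₁ · R_N` with `R_N` the auxiliary polynomial of
    `exists_royAuxPoly` at `(1.3, 0.7, 1.2, 0.45, 1.322)`: the translate `m = 0` is `(0,1) = (0,e^0)`
    (Cauchy estimate on `|z| = 1`), the translates `m ≥ 1` are `(m, 0)` where `X₁ ∣ D^k(X₁R_N)`.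
  - the window inequality `max(1,t₀,2t₁) < min(s₀,2s₁)` (W1): FALSE without it, positivity and BOTH
    `u`-inequalities kept (`crux_false_without_W1`): `(1, 1)`, `(s₀,s₁,t₀,t₁,u) = (1/2, 1, 10, 1, 3)`,
    `P_N = (X₁ − 1)^{⌊√N⌋+1}` with EXACT zeros (`royHypothesis_one_one`: works whenever
    `s₀ < min(1, t₀, t₁)`); a fortiori `crux_false_without_admissible`.
* §2 NOT LOAD-BEARING (hypothesis mutation that changes nothing): the two `u`-inequalities of (1)
  BEYOND Theorem 1's `min(s₀,2s₁) < u` — i.e. `u > max(s₀, s₁+t₁)` and the upper bound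
  `u < (1+t₀+t₁)/2` — carry no truth content: the crux on Theorem 1's strictly wider window
  (`RoyThm1Window`, `royThm1Window_not_admissible`) is STILL equivalent to Schanuel
  (`cruxWideWindow_iff_schanuel`, from `Roy2001_prop3_holds`), hence to the crux
  (`cruxWideWindow_iff_crux`). They only serve the converse (Thm 3 / `royHypothesis_exp'` needs
  `u < (1+t₀+t₁)/2`): they make Conjecture 2 NECESSARY for Schanuel, not sufficient. For the prover:
  any argument may assume `u` as large as convenient relative to `s₀, s₁` is NOT available — the
  other direction: one must handle `u` barely above `max(s₀, s₁+t₁)`; but nothing is lost by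
  forgetting the upper bound on `u`.
* §3 TIGHTNESS / NON-VACUITY / RANK ONE. `not_cruxSucc`: the conclusion `trdeg ≥ n` cannot be
  improved to `≥ n+1` (`(1, e)`, hypothesis by `royHypothesis_exp'`, `trdeg ℚ(e) ≤ 1`).
  `royHypothesis_on_graph`: the hypothesis holds on the graph of `exp` for every `y` and every
  admissible tuple (non-vacuity at all ranks). `rankOne_decided`: for `α ≠ 0` and admissible
  parameters `RoyHypothesis (y) (α) ↔ ∃ d ≥ 1, α^d = e^{dy}` (Roy's Thm 1, both directions proved in
  tree: `Roy2001_thm1_holds`) — in rank one the hypothesis holds EXACTLY on torsion translates of the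
  graph, so no rank-one counterexample exists and the smallest possible counterexample has rank 2.
* §4 NATURAL STRENGTHENINGS / VARIANTS REFUTED. `not_cruxNoDeriv`: with the derivatives deleted
  (values only, `k = 0`) the criterion is false at `(1,1)` with `P_N = X₁ − 1` (degree 1, height 1) —
  multiplicity `k ≤ N^{s₀}`, `s₀ > 1`, is essential. `not_cruxPartial0`: with `D` replaced by the
  additive derivation `∂/∂X₀` alone the criterion is false (same witness; `∂₀(X₁ − 1) = 0`) — the
  `𝔾ₘ`-component `X₁∂₁` of `D` is essential. `CruxFrequently` (hypothesis for infinitely many `N`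
  only) implies the crux (`crux_of_cruxFrequently`); NOT refuted: in rank one it is true whenever
  `arg(α e^{−y})/2π` has finite irrationality measure (Roy's Prop. 3 proof with Lemma 4 replaced by
  such a measure; e.g. Baker/Fel'dman for algebraic data), which the tree does not have — recorded as
  the only variant whose status we could not settle.
* §5 A STRUCTURAL CONSTRAINT every datum satisfies (`royHypothesis_exact_at_origin`): the translate
  `m = 0` is the integer point `(0, 1) = (0, e^0)` for ALL `(y, α)`, and `D^kP_N(0,1) ∈ ℤ`, so the
  hypothesis forces EXACT vanishing `D^k P_N(0,1) = 0`, `k ≤ N^{s₀}`: `t ↦ P_N(t, e^t)` vanishes at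
  `0` to order `> N^{s₀}` (`> N` coefficients' worth of conditions against `≈ N^{t₀+t₁}` unknowns;
  consistent because `s₀ < u < (1+t₀+t₁)/2 < t₀ + t₁` in the window). Every `P_N` is therefore a
  Thue–Siegel auxiliary polynomial for `e^z` at the origin, whatever `(y, α)` is.
* `-- Targets`: none (payload `stuck_stubs = []`, no line picked yet).
* `-- Near-misses`: none needing `sorry`.

## WHY IT RESISTS (the negative side's census, numbers not adjectives)

(1) LOGICAL: `RoyThesis ↔ Schanuel` is kernel-checked; ranks `0, 1` are proved; so `¬RoyThesis`
needs `y ∈ ℂⁿ`, `n ≥ 2`, `ℚ`-linearly independent with `trdeg ℚ(y, e^y) ≤ n − 1`. The classical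
candidates `(1, iπ)`, `(1, e)`, `(log 2, √2 log 2)`, `(iπ, log 2)` would need an algebraic relation
between `e` and `π`, resp. `e` and `e^e`, `log 2` and `2^{√2}`, `π` and `log 2` — open since 1966,
universally expected false; essential counterexamples live in `ecl(∅)` (Kirby 2010, Prop. 7.2, in
tree as `schanuelConjecture_iff_ecl_empty_holds`). No decidable instance, no `kit` search applies:
the statement quantifies over `ℂ` and over all large `N`. (2) ENCODING: no junk handle — `rpow` on
`N ≥ 1`, `degreeOf`, `mvPolyHeight = max |coeff|`, `aeval` at `(Σ mⱼyⱼ, Π αⱼ^{mⱼ})`, `∀ᶠ N` = "all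
sufficiently large `N`" (grounder-verified against p. 183), `m = 0` admitted (gives §5, harmless).
The rank-one sanity item `RoyCriterionRankOne` is TRUE in tree (`royCriterion_one`), so the
definitions `RoyHypothesis/RoyAdmissible` carry no bug a refuter could exploit. (3) HYPOTHESES: each
of `LinearIndependent`, `α ≠ 0`, W1 is necessary (§1) and the witnesses are the cheapest possible
(`y = 0`; `α = 0` with `X₁ ∣ P`; the integer point `(1,1)` with `(X₁−1)^K`); inside the window the
integer/rational-point mechanisms die: exact vanishing at `(m, 1)` to order `N^{s₀}` with
`deg_{X₁} ≤ N^{t₁}`, `2t₁ < s₀`, is forbidden (zero estimate on `𝔾ₐ × 𝔾ₘ`; Roy's Thm 1 in tree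
makes this precise: off torsion translates of the graph the rank-one hypothesis FAILS), and Dirichlet's
box principle needs `1 + t₀ + t₁ > s₀ + s₁ + max(s₀, s₁+t₁, u)`, impossible under W1 (`s₀ > 1`,
`s₀ > t₀`, `s₁ > t₁`). (4) So every route to `¬RoyThesis` is a route to `¬Schanuel`; the crux is
graded open-problem correctly, and its value for the programme is Roy's: a target with nothing
transcendental to verify. Provers: the informative sub-targets are the METHOD cruxes
`RoySmallValueDirichletGap` / `NguyenRoySmallValueTranslates` (see their Disproof files), not this one.
-/

noncomputable section

set_option linter.dupNamespace false

namespace Summit.Schanuel.Schanuel.Cruxes.RoyThesis.Disproof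

open MvPolynomial Filter Complex Metric
open Literature.NumberTheory.Transcendental
open Summit.Schanuel.Schanuel.Theses.RoyCriterion (RoyThesis RoyThesisTyped)
open Summit.Schanuel.Schanuel.Theorems.RoySmallValueDirichletGapTauCount
  (aeval_iterate_royD_pow_eq_zero X_one_sub_one_ne_zero totalDegree_pow_X_one_sub_one_le
    mvPolyHeight_pow_X_one_sub_one_le eventually_nat_mul_rpow_le_rpow)

/-! ## §0 Read-back and the resistance certificate -/

/-- READ-BACK: the crux, verbatim. -/
theorem crux_iff : RoyThesis ↔ ∀ n, RoyCriterion n := Iff.rfl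

/-- The crux and its typed twin `RoyThesisTyped` (`stmt-Schanuel-0463`) are the same term. -/
theorem crux_eq_typed : RoyThesis = RoyThesisTyped := rfl

/-- **RESISTANCE CERTIFICATE.** The crux is equivalent to Schanuel's conjecture (Roy 2001, §1 + Thm 1,
proved in tree as `Roy2001_iff_holds`; `Schanuel` unfolds to `∀ l, SchanuelRank l`).
[cite: Roy2001, §1 and Thm. 1] -/
theorem crux_iff_schanuel : RoyThesis ↔ _root_.Schanuel :=
  ⟨fun h n => (Roy2001_iff_holds n).mp (h n), fun h n => (Roy2001_iff_holds n).mpr (h n)⟩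

/-- A disproof of the crux is a disproof of Schanuel's conjecture. -/
theorem not_crux_iff_not_schanuel : ¬ RoyThesis ↔ ¬ _root_.Schanuel := not_congr crux_iff_schanuel

/-- Rank one of Roy's criterion is a theorem (Hermite–Lindemann through Roy's equivalence).
[cite: Roy2001, p. 184] -/
theorem royCriterion_one : RoyCriterion 1 :=
  Literature.Transcend.royCriterion_one_of_facts Roy2001_iff_holds transcendental_exp_holds

/-- Ranks `0, 1` hold, so the crux is its restriction to ranks `≥ 2`. -/
theorem crux_iff_forall_two_le : RoyThesis ↔ ∀ n, 2 ≤ n → RoyCriterion n := by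
  refine ⟨fun h n _ => h n, fun h n => ?_⟩
  rcases Nat.lt_or_ge n 2 with hn | hn
  · interval_cases n
    · exact royCriterion_zero
    · exact royCriterion_one
  · exact h n hn

/-- **What a kill must be**: a `ℚ`-linearly independent `y ∈ ℂⁿ`, `n ≥ 2`, with
`trdeg ℚ(y, e^y) < n` — a counterexample to Schanuel's conjecture. -/
theorem not_crux_iff_exists_counterexample :
    ¬ RoyThesis ↔ ∃ n, 2 ≤ n ∧ ∃ y : Fin n → ℂ, LinearIndependent ℚ y ∧
      Algebra.trdeg ℚ ↥(IntermediateField.adjoin ℚ (Set.range y ∪ Set.range (cexp ∘ y))) < n := by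
  rw [crux_iff_forall_two_le]
  push Not
  refine exists_congr fun n => and_congr Iff.rfl ?_
  rw [Roy2001_iff_holds n]
  unfold SchanuelRank
  push Not
  rfl

/-! ## Toolbox -/

/-- An adjunction of algebraic numbers has transcendence degree `0`. [folklore] -/
theorem trdeg_adjoin_eq_zero {S : Set ℂ} (hS : ∀ x ∈ S, IsIntegral ℚ x) :
    Algebra.trdeg ℚ ↥(IntermediateField.adjoin ℚ S) = 0 := by
  rw [trdeg_eq_zero_iff]
  exact IntermediateField.isAlgebraic_adjoin hS

open scoped IntermediateField.algebraAdjoinAdjoin in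
/-- `trdeg_ℚ ℚ(t) ≤ 1`. [folklore] -/
theorem trdeg_adjoin_simple_le_one (t : ℂ) :
    Algebra.trdeg ℚ ↥(IntermediateField.adjoin ℚ ({t} : Set ℂ)) ≤ 1 := by
  classical
  let Lt : IntermediateField ℚ ℂ := IntermediateField.adjoin ℚ ({t} : Set ℂ)
  let t' : Lt := ⟨t, IntermediateField.mem_adjoin_simple_self ℚ t⟩
  have hmap : Subalgebra.map Lt.val (Algebra.adjoin ℚ ({t'} : Set Lt)) =
      Algebra.adjoin ℚ ({t} : Set ℂ) := by
    rw [AlgHom.map_adjoin, Set.image_singleton]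
    rfl
  let e : Algebra.adjoin ℚ ({t'} : Set Lt) ≃ₐ[ℚ] Algebra.adjoin ℚ ({t} : Set ℂ) :=
    (Subalgebra.equivMapOfInjective _ Lt.val Subtype.val_injective).trans
      (Subalgebra.equivOfEq _ _ hmap)
  haveI : Algebra.IsAlgebraic (Algebra.adjoin ℚ ({t'} : Set Lt)) Lt := by
    refine ⟨fun y => ?_⟩
    have hy : IsAlgebraic (Algebra.adjoin ℚ ({t} : Set ℂ)) (y : Lt) :=
      Algebra.IsAlgebraic.isAlgebraic y
    refine IsAlgebraic.of_ringHom_of_comp_eq (e : _ →+* _) (RingHom.id Lt) (by simpa using hy)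
      e.surjective Function.injective_id ?_
    ext x
    rfl
  have h := Algebra.IsAlgebraic.trdeg_le_cardinalMk (R := ℚ) ({t'} : Set Lt)
  simpa using h

/-- `trdeg_ℚ ℚ(S) ≤ 1` when `S ⊆ ℚ(t)`. [folklore] -/
theorem trdeg_adjoin_le_one_of_subset {S : Set ℂ} (t : ℂ)
    (hS : S ⊆ IntermediateField.adjoin ℚ ({t} : Set ℂ)) :
    Algebra.trdeg ℚ ↥(IntermediateField.adjoin ℚ S) ≤ 1 := by
  have hle : IntermediateField.adjoin ℚ S ≤ IntermediateField.adjoin ℚ ({t} : Set ℂ) :=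
    IntermediateField.adjoin_le_iff.mpr hS
  exact (trdeg_le_of_injective (IntermediateField.inclusion hle)
    (IntermediateField.inclusion_injective hle)).trans (trdeg_adjoin_simple_le_one t)

/-- `(1)` is a `ℚ`-linearly independent family of rank one. -/
theorem linearIndependent_one : LinearIndependent ℚ (![1] : Fin 1 → ℂ) :=
  linearIndependent_unique_iff.2 (by simp)

/-- The rank-one conclusion fails at `(1, c)` for algebraic `c`: `trdeg ℚ(1, c) = 0`. -/
theorem not_one_le_trdeg_one {c : ℂ} (hc : IsIntegral ℚ c) :
    ¬ ((1 : ℕ) : Cardinal) ≤ Algebra.trdeg ℚ ↥(IntermediateField.adjoin ℚ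
      (Set.range (![1] : Fin 1 → ℂ) ∪ Set.range (![c] : Fin 1 → ℂ))) := by
  rw [trdeg_adjoin_eq_zero]
  · simp
  · rintro x (⟨j, rfl⟩ | ⟨j, rfl⟩)
    · have : (![(1 : ℂ)] j) = 1 := by fin_cases j; rfl
      rw [this]; exact isIntegral_one
    · have : (![c] j) = c := by fin_cases j; rfl
      rw [this]; exact hc

/-- The evaluation point of Roy's hypothesis for the rank-one datum `(1, α)` is `(m, α^m)`. -/
theorem point_one (α : ℂ) (m : Fin 1 → ℕ) :
    (![∑ j, (m j : ℂ) * (![(1 : ℂ)] : Fin 1 → ℂ) j, ∏ j, (![α] : Fin 1 → ℂ) j ^ m j] : Fin 2 → ℂ) =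
      ![(m 0 : ℂ), α ^ m 0] := by
  simp

/-- `2 ≤ e`. -/
theorem two_le_exp_one : (2 : ℝ) ≤ Real.exp 1 := by
  have := Real.add_one_le_exp (1 : ℝ); norm_num at this; linarith

/-- Height of `X₁ − 1` is `≤ 1`. -/
theorem mvPolyHeight_X_one_sub_one_le : mvPolyHeight (X 1 - 1 : MvPolynomial (Fin 2) ℤ) ≤ 1 := by
  classical
  refine Finset.sup_le fun m _ => ?_
  rw [coeff_sub, coeff_X, coeff_one]
  split_ifs <;> simp

/-- `deg_{X₀}(X₁ − 1) = 0`. -/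
theorem degreeOf_zero_X_one_sub_one : (X 1 - 1 : MvPolynomial (Fin 2) ℤ).degreeOf 0 = 0 := by
  have h := degreeOf_sub_le (0 : Fin 2) (X 1 : MvPolynomial (Fin 2) ℤ) 1
  rw [degreeOf_X, show (1 : MvPolynomial (Fin 2) ℤ) = C 1 from rfl, degreeOf_C] at h
  simpa using h

/-- `deg_{X₁}(X₁ − 1) ≤ 1`. -/
theorem degreeOf_one_X_one_sub_one : (X 1 - 1 : MvPolynomial (Fin 2) ℤ).degreeOf 1 ≤ 1 := by
  have h := degreeOf_sub_le (1 : Fin 2) (X 1 : MvPolynomial (Fin 2) ℤ) 1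
  rw [degreeOf_X, show (1 : MvPolynomial (Fin 2) ℤ) = C 1 from rfl, degreeOf_C] at h
  simpa using h

/-- `D^k (X₁ R) ∈ X₁ ℤ[X₀, X₁]` (because `D X₁ = X₁`). -/
theorem exists_iterate_royD_X_one_mul (k : ℕ) (R : MvPolynomial (Fin 2) ℤ) :
    ∃ Q : MvPolynomial (Fin 2) ℤ, royD^[k] (X 1 * R) = X 1 * Q := by
  induction k with
  | zero => exact ⟨R, rfl⟩
  | succ k ih =>
    obtain ⟨Q, hQ⟩ := ih
    refine ⟨Q + royD Q, ?_⟩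
    rw [Function.iterate_succ_apply', hQ, royD_mul, royD_X_one]
    ring

/-- Multiplying by a variable does not raise the height. -/
theorem mvPolyHeight_X_mul_le (i : Fin 2) (R : MvPolynomial (Fin 2) ℤ) :
    mvPolyHeight (X i * R) ≤ mvPolyHeight R := by
  classical
  refine Finset.sup_le fun m _ => ?_
  rw [coeff_X_mul']
  split_ifs
  · exact natAbs_coeff_le_mvPolyHeight _ _
  · simp

/-- `deg_{X_i}(X_j R) ≤ [i = j] + deg_{X_i} R`. -/
theorem degreeOf_X_mul_le (i j : Fin 2) (R : MvPolynomial (Fin 2) ℤ) :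
    (X j * R).degreeOf i ≤ (if i = j then 1 else 0) + R.degreeOf i := by
  classical
  exact (degreeOf_mul_le _ _ _).trans (by rw [degreeOf_X])

/-! ## §1 Load-bearing hypotheses -/

/-! ### (a1) `LinearIndependent ℚ y` -/

/-- The crux with `LinearIndependent ℚ y` DELETED (verbatim otherwise). -/
def CruxWithoutLinearIndependent : Prop :=
  ∀ (n : ℕ) (y α : Fin n → ℂ), (∀ j, α j ≠ 0) →
    ∀ (s₀ s₁ t₀ t₁ u : ℝ), RoyAdmissible s₀ s₁ t₀ t₁ u → RoyHypothesis y α s₀ s₁ t₀ t₁ u →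
      (n : Cardinal) ≤ Algebra.trdeg ℚ ↥(IntermediateField.adjoin ℚ (Set.range y ∪ Set.range α))

/-- **Without linear independence the criterion fails at EVERY rank `n ≥ 1` and EVERY admissible
tuple**: `y = 0`, `α = e^0 = 1`; the hypothesis holds by the in-tree auxiliary polynomial
`royHypothesis_exp'` (Thue–Siegel + Schwarz), and `trdeg ℚ(0, 1) = 0`. -/
theorem withoutLinearIndependent_fails_everywhere {n : ℕ} (hn : 1 ≤ n) {s₀ s₁ t₀ t₁ u : ℝ}
    (hadm : RoyAdmissible s₀ s₁ t₀ t₁ u) :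
    ∃ y α : Fin n → ℂ, (∀ j, α j ≠ 0) ∧ RoyHypothesis y α s₀ s₁ t₀ t₁ u ∧
      ¬ (n : Cardinal) ≤ Algebra.trdeg ℚ ↥(IntermediateField.adjoin ℚ (Set.range y ∪ Set.range α)) := by
  refine ⟨0, cexp ∘ 0, fun j => Complex.exp_ne_zero _, royHypothesis_exp' 0 hadm, ?_⟩
  rw [trdeg_adjoin_eq_zero]
  · have : (1 : Cardinal) ≤ n := by exact_mod_cast hn
    intro h
    exact (lt_of_lt_of_le zero_lt_one (this.trans h)).ne rfl
  · haveI : NeZero n := ⟨by omega⟩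
    rintro x (⟨j, rfl⟩ | ⟨j, rfl⟩)
    · simpa using isIntegral_zero
    · simpa using isIntegral_one

/-- **`LinearIndependent ℚ y` is load-bearing.** -/
theorem crux_false_without_linearIndependent : ¬ CruxWithoutLinearIndependent := by
  intro h
  obtain ⟨y, α, hα, hhyp, hnot⟩ :=
    withoutLinearIndependent_fails_everywhere (n := 1) le_rfl royAdmissible_example
  exact hnot (h 1 y α hα _ _ _ _ _ royAdmissible_example hhyp)

/-! ### (a2) `α_j ≠ 0` -/

/-- An auxiliary admissible tuple just inside Roy's example `(1.3, 0.7, 1.2, 0.5, 1.32)`: smaller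
`t₁` (room for one extra factor `X₁`) and larger `u` (room for a factor `e · e^{N^{1.32}}`). -/
theorem royAdmissible_aux : RoyAdmissible 1.3 0.7 1.2 0.45 1.322 := by
  refine ⟨by norm_num, by norm_num, by norm_num, by norm_num, by norm_num, ?_, ?_, by norm_num⟩ <;>
    norm_num

/-- **Witness for `α = 0`**: Roy's hypothesis holds for `(y, α) = (1, 0)` at Roy's example parameters
with `P_N = X₁ · R_N`, `R_N` the auxiliary polynomial of `exists_royAuxPoly` (tuple
`royAdmissible_aux`, radius `1`): the translate `m = 0` is `(0, 1) = (0, e^0)`, where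
`|D^k(X₁R_N)(0,1)| ≤ k!·e·e^{−2N^{1.322}}` by Cauchy on `|z| = 1`; the translates `m ≥ 1` are
`(m, 0)`, where `X₁ ∣ D^k(X₁ R_N)` vanishes. -/
theorem royHypothesis_one_zero : RoyHypothesis (![1] : Fin 1 → ℂ) ![0] 1.3 0.7 1.2 0.5 1.32 := by
  have hA := royAdmissible_aux
  have h45 : (0.45 : ℝ) < 0.5 := by norm_num
  have h32 : (1.32 : ℝ) < 1.322 := by norm_num
  filter_upwards [exists_royAuxPoly hA le_rfl (c := 0), eventually_roy_params hA le_rfl (c := 0),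
    eventually_nat_mul_rpow_le_rpow 2 h45, eventually_nat_mul_rpow_le_rpow 2 h32,
    eventually_ge_atTop 1] with N hR hpar g1 g2 hN
  have hN1 : (1 : ℝ) ≤ N := by exact_mod_cast hN
  obtain ⟨R, hR0, hd0, hd1, hH, hval⟩ := hR
  obtain ⟨-, -, -, hfact⟩ := hpar
  refine ⟨X 1 * R, mul_ne_zero (X_ne_zero _) hR0, ?_, ?_, ?_, fun k m hk _ => ?_⟩
  · calc (((X 1 * R).degreeOf 0 : ℕ) : ℝ) ≤ ((R.degreeOf 0 : ℕ) : ℝ) := by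
          exact_mod_cast (degreeOf_X_mul_le 0 1 R).trans (by simp)
      _ ≤ (N : ℝ) ^ (1.2 : ℝ) := hd0
  · calc (((X 1 * R).degreeOf 1 : ℕ) : ℝ) ≤ 1 + ((R.degreeOf 1 : ℕ) : ℝ) := by
          exact_mod_cast (degreeOf_X_mul_le 1 1 R).trans (by simp)
      _ ≤ 1 + (N : ℝ) ^ (0.45 : ℝ) := by linarith
      _ ≤ 2 * (N : ℝ) ^ (0.45 : ℝ) := by
          have : (1 : ℝ) ≤ (N : ℝ) ^ (0.45 : ℝ) := Real.one_le_rpow hN1 (by norm_num)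
          linarith
      _ ≤ (N : ℝ) ^ (0.5 : ℝ) := g1
  · calc ((mvPolyHeight (X 1 * R) : ℕ) : ℝ) ≤ ((mvPolyHeight R : ℕ) : ℝ) := by
          exact_mod_cast mvPolyHeight_X_mul_le 1 R
      _ ≤ Real.exp N := hH
  · rw [point_one]
    rcases Nat.eq_zero_or_pos (m 0) with h0 | hpos
    · -- the translate `m = 0`: the point `(0, 1) = (0, e^0)` on the graph of `exp`
      rw [h0, pow_zero, Nat.cast_zero]
      have hsphere : ∀ z ∈ sphere (0 : ℂ) 1,
          ‖expEval (X 1 * R) z‖ ≤ Real.exp 1 * Real.exp (-(2 * (N : ℝ) ^ (1.322 : ℝ))) := by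
        intro z hz
        have hz1 : ‖z‖ = 1 := by simpa using hz
        rw [expEval_apply, map_mul, norm_mul]
        refine mul_le_mul ?_ (hval z (by simp [hz1])) (norm_nonneg _) (Real.exp_pos _).le
        have : aeval ![z, cexp z] (X 1 : MvPolynomial (Fin 2) ℤ) = cexp z := by simp
        rw [this, Complex.norm_exp]
        exact Real.exp_le_exp.2 ((Complex.re_le_norm z).trans hz1.le)
      have hC := norm_expEval_iterate_royD_le k (X 1 * R) 0 hsphere
      rw [expEval_apply, Complex.exp_zero] at hC
      calc ‖aeval ![(0 : ℂ), 1] (royD^[k] (X 1 * R))‖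
          ≤ k.factorial * (Real.exp 1 * Real.exp (-(2 * (N : ℝ) ^ (1.322 : ℝ)))) := hC
        _ = Real.exp 1 * (k.factorial * Real.exp (-(2 * (N : ℝ) ^ (1.322 : ℝ)))) := by ring
        _ ≤ Real.exp 1 * Real.exp (-(N : ℝ) ^ (1.322 : ℝ)) :=
            mul_le_mul_of_nonneg_left (hfact k hk) (Real.exp_pos _).le
        _ = Real.exp (1 - (N : ℝ) ^ (1.322 : ℝ)) := by rw [← Real.exp_add]; ring_nf
        _ ≤ Real.exp (-(N : ℝ) ^ (1.32 : ℝ)) := by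
            refine Real.exp_le_exp.2 ?_
            have : (1 : ℝ) ≤ (N : ℝ) ^ (1.32 : ℝ) := Real.one_le_rpow hN1 (by norm_num)
            linarith
    · -- the translates `m ≥ 1`: the point `(m, 0)`, where `X₁ ∣ D^k (X₁ R)` vanishes
      obtain ⟨Q, hQ⟩ := exists_iterate_royD_X_one_mul k R
      rw [zero_pow hpos.ne', hQ, map_mul]
      simp [(Real.exp_pos _).le]

/-- The crux with the side condition `∀ j, α j ≠ 0` DELETED (verbatim otherwise). -/
def CruxWithoutUnits : Prop :=
  ∀ (n : ℕ) (y α : Fin n → ℂ), LinearIndependent ℚ y →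
    ∀ (s₀ s₁ t₀ t₁ u : ℝ), RoyAdmissible s₀ s₁ t₀ t₁ u → RoyHypothesis y α s₀ s₁ t₀ t₁ u →
      (n : Cardinal) ≤ Algebra.trdeg ℚ ↥(IntermediateField.adjoin ℚ (Set.range y ∪ Set.range α))

/-- **`α_j ≠ 0` is load-bearing**: `(y, α) = (1, 0)` (rank one, `y` linearly independent,
`trdeg ℚ(1, 0) = 0`), Roy's example parameters, `P_N = X₁ R_N` (`royHypothesis_one_zero`). -/
theorem crux_false_without_units : ¬ CruxWithoutUnits := fun h =>
  not_one_le_trdeg_one isIntegral_zero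
    (h 1 ![1] ![0] linearIndependent_one _ _ _ _ _ royAdmissible_example royHypothesis_one_zero)

/-! ### (a3) The window inequality `max(1, t₀, 2t₁) < min(s₀, 2s₁)` -/

/-- **Witness family at the integer point `(1, 1)`**: whenever `s₀ < min(1, t₀, t₁)` (so OUTSIDE
Roy's window, which has `2t₁ < s₀` and `1 < s₀`), Roy's hypothesis holds for `(y, α) = (1, 1)` with
`P_N = (X₁ − 1)^{⌊N^{s₀}⌋+1}` and EXACT zeros `D^k P_N(m, 1) = 0`, `k ≤ N^{s₀}`, all `m`, for every
`s₁` and `u`. [cite: Roy2001, §1 (1)] -/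
theorem royHypothesis_one_one {s₀ s₁ t₀ t₁ u : ℝ} (hs₀ : 0 ≤ s₀) (h0 : s₀ < t₀) (h1 : s₀ < t₁)
    (h2 : s₀ < 1) : RoyHypothesis (![1] : Fin 1 → ℂ) ![1] s₀ s₁ t₀ t₁ u := by
  filter_upwards [eventually_nat_mul_rpow_le_rpow 2 h0, eventually_nat_mul_rpow_le_rpow 2 h1,
    eventually_nat_mul_rpow_le_rpow 2 h2, eventually_ge_atTop 1] with N e0 e1 e2 hN
  have hpow0 : (0 : ℝ) ≤ (N : ℝ) ^ s₀ := Real.rpow_nonneg (Nat.cast_nonneg N) _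
  have hpow1 : (1 : ℝ) ≤ (N : ℝ) ^ s₀ := Real.one_le_rpow (by exact_mod_cast hN) hs₀
  set K : ℕ := ⌊(N : ℝ) ^ s₀⌋₊ with hK
  have hK2 : ((K + 1 : ℕ) : ℝ) ≤ 2 * (N : ℝ) ^ s₀ := by
    push_cast
    have : (K : ℝ) ≤ (N : ℝ) ^ s₀ := Nat.floor_le hpow0
    linarith
  refine ⟨(X 1 - 1) ^ (K + 1), pow_ne_zero _ X_one_sub_one_ne_zero, ?_, ?_, ?_, fun k m hk _ => ?_⟩
  · calc (((X 1 - 1 : MvPolynomial (Fin 2) ℤ) ^ (K + 1)).degreeOf 0 : ℝ) ≤ ((K + 1 : ℕ) : ℝ) := by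
          exact_mod_cast (degreeOf_le_totalDegree _ _).trans (totalDegree_pow_X_one_sub_one_le _)
      _ ≤ (N : ℝ) ^ t₀ := hK2.trans e0
  · calc (((X 1 - 1 : MvPolynomial (Fin 2) ℤ) ^ (K + 1)).degreeOf 1 : ℝ) ≤ ((K + 1 : ℕ) : ℝ) := by
          exact_mod_cast (degreeOf_le_totalDegree _ _).trans (totalDegree_pow_X_one_sub_one_le _)
      _ ≤ (N : ℝ) ^ t₁ := hK2.trans e1
  · calc ((mvPolyHeight ((X 1 - 1 : MvPolynomial (Fin 2) ℤ) ^ (K + 1)) : ℕ) : ℝ)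
          ≤ ((2 ^ (K + 1) : ℕ) : ℝ) := by exact_mod_cast mvPolyHeight_pow_X_one_sub_one_le _
      _ = (2 : ℝ) ^ (K + 1) := by push_cast; ring
      _ ≤ Real.exp 1 ^ (K + 1) := pow_le_pow_left₀ (by norm_num) two_le_exp_one _
      _ = Real.exp ((K + 1 : ℕ) : ℝ) := by rw [← Real.exp_one_pow]
      _ ≤ Real.exp N := Real.exp_le_exp.2 (hK2.trans (by simpa using e2))
  · have hk' : k < K + 1 := Nat.lt_succ_of_le (Nat.le_floor hk)
    rw [point_one, one_pow, aeval_iterate_royD_pow_eq_zero _ hk', norm_zero]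
    exact (Real.exp_pos _).le

/-- The crux with the first window inequality `max(1, t₀, 2t₁) < min(s₀, 2s₁)` DELETED
(positivity and `max(s₀, s₁+t₁) < u < (1+t₀+t₁)/2` kept; verbatim otherwise). -/
def CruxWithoutW1 : Prop :=
  ∀ (n : ℕ) (y α : Fin n → ℂ), LinearIndependent ℚ y → (∀ j, α j ≠ 0) →
    ∀ (s₀ s₁ t₀ t₁ u : ℝ), 0 < s₀ → 0 < s₁ → 0 < t₀ → 0 < t₁ → 0 < u →
      max s₀ (s₁ + t₁) < u → u < (1 + t₀ + t₁) / 2 →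
      RoyHypothesis y α s₀ s₁ t₀ t₁ u →
      (n : Cardinal) ≤ Algebra.trdeg ℚ ↥(IntermediateField.adjoin ℚ (Set.range y ∪ Set.range α))

/-- **`max(1, t₀, 2t₁) < min(s₀, 2s₁)` is load-bearing**: witness `(y, α) = (1, 1)`,
`(s₀, s₁, t₀, t₁, u) = (1/2, 1, 10, 1, 3)` (positivity and both `u`-inequalities hold; the deleted
inequality fails through `1 < s₀`, `t₀ < s₀`, `2t₁ < s₀`, `t₀ < 2s₁`, `2t₁ < 2s₁`),
`P_N = (X₁ − 1)^{⌊√N⌋+1}`. -/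
theorem crux_false_without_W1 : ¬ CruxWithoutW1 := fun h =>
  not_one_le_trdeg_one isIntegral_one (h 1 ![1] ![1] linearIndependent_one (fun j => by simp)
    (1 / 2) 1 10 1 3 (by norm_num) (by norm_num) (by norm_num) (by norm_num) (by norm_num)
    (by norm_num) (by norm_num)
    (royHypothesis_one_one (by norm_num) (by norm_num) (by norm_num) (by norm_num)))

/-- The crux with the whole window `RoyAdmissible` DELETED (parameters arbitrary reals). -/
def CruxWithoutAdmissible : Prop :=
  ∀ (n : ℕ) (y α : Fin n → ℂ), LinearIndependent ℚ y → (∀ j, α j ≠ 0) →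
    ∀ (s₀ s₁ t₀ t₁ u : ℝ), RoyHypothesis y α s₀ s₁ t₀ t₁ u →
      (n : Cardinal) ≤ Algebra.trdeg ℚ ↥(IntermediateField.adjoin ℚ (Set.range y ∪ Set.range α))

/-- A fortiori the window cannot be dropped altogether. -/
theorem crux_false_without_admissible : ¬ CruxWithoutAdmissible := fun h =>
  crux_false_without_W1 fun n y α hy hα s₀ s₁ t₀ t₁ u _ _ _ _ _ _ _ hh => h n y α hy hα s₀ s₁ t₀ t₁ u hh

/-! ## §2 NOT load-bearing: the `u`-inequalities beyond Theorem 1's (the wide window is still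
equivalent to Schanuel) -/

/-- Roy's THEOREM-1 window (Roy 2001, Thm. 1 / Prop. 3): positivity, `max(1, t₀, 2t₁) < min(s₀, 2s₁)`
and `min(s₀, 2s₁) < u` — no upper bound on `u`, and `u` need not exceed `max(s₀, s₁ + t₁)`.
[cite: Roy2001, Thm. 1] -/
def RoyThm1Window (s₀ s₁ t₀ t₁ u : ℝ) : Prop :=
  0 < s₀ ∧ 0 < s₁ ∧ 0 < t₀ ∧ 0 < t₁ ∧ 0 < u ∧
    max 1 (max t₀ (2 * t₁)) < min s₀ (2 * s₁) ∧ min s₀ (2 * s₁) < u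

/-- Conjecture 2's window (1) lies inside Theorem 1's window. -/
theorem royThm1Window_of_royAdmissible {s₀ s₁ t₀ t₁ u : ℝ} (h : RoyAdmissible s₀ s₁ t₀ t₁ u) :
    RoyThm1Window s₀ s₁ t₀ t₁ u := by
  obtain ⟨hs₀, hs₁, ht₀, ht₁, hu, h1, h2, -⟩ := h
  exact ⟨hs₀, hs₁, ht₀, ht₁, hu, h1,
    lt_of_le_of_lt (min_le_left _ _) (lt_of_le_of_lt (le_max_left _ _) h2)⟩

/-- Theorem 1's window is strictly larger, in BOTH excess inequalities of (1):
`(1.3, 0.7, 1.2, 0.5, 100)` is in it but violates `u < (1 + t₀ + t₁)/2`, and `(2, 0.7, 1.2, 0.5, 1.5)`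
is in it but violates `max(s₀, s₁ + t₁) < u`. -/
theorem royThm1Window_not_admissible :
    RoyThm1Window 1.3 0.7 1.2 0.5 100 ∧ ¬ RoyAdmissible 1.3 0.7 1.2 0.5 100 ∧
    RoyThm1Window 2 0.7 1.2 0.5 1.5 ∧ ¬ RoyAdmissible 2 0.7 1.2 0.5 1.5 := by
  refine ⟨?_, ?_, ?_, ?_⟩
  · refine ⟨by norm_num, by norm_num, by norm_num, by norm_num, by norm_num, ?_, ?_⟩ <;> norm_num
  · rintro ⟨-, -, -, -, -, -, -, h⟩; norm_num at h
  · refine ⟨by norm_num, by norm_num, by norm_num, by norm_num, by norm_num, ?_, ?_⟩ <;> norm_num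
  · rintro ⟨-, -, -, -, -, -, h, -⟩; norm_num at h

/-- The crux on Theorem 1's (wider) window. -/
def CruxWideWindow : Prop :=
  ∀ (n : ℕ) (y α : Fin n → ℂ), LinearIndependent ℚ y → (∀ j, α j ≠ 0) →
    ∀ (s₀ s₁ t₀ t₁ u : ℝ), RoyThm1Window s₀ s₁ t₀ t₁ u → RoyHypothesis y α s₀ s₁ t₀ t₁ u →
      (n : Cardinal) ≤ Algebra.trdeg ℚ ↥(IntermediateField.adjoin ℚ (Set.range y ∪ Set.range α))

/-- The wide-window crux implies the crux (more parameter tuples). -/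
theorem crux_of_cruxWideWindow (h : CruxWideWindow) : RoyThesis := fun n y α hy hα s₀ s₁ t₀ t₁ u hadm =>
  h n y α hy hα s₀ s₁ t₀ t₁ u (royThm1Window_of_royAdmissible hadm)

/-- `(b) ⇒ (a)` of Theorem 1 on Theorem 1's own window, from Proposition 3 (proved in tree).
[cite: Roy2001, Prop. 3] -/
theorem condA_of_condB_wide {y α : ℂ} (hα : α ≠ 0) {s₀ s₁ t₀ t₁ u : ℝ} (hw : RoyThm1Window s₀ s₁ t₀ t₁ u)
    (hb : RoyConditionB y α s₀ s₁ t₀ t₁ u) : RoyConditionA y α := by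
  obtain ⟨hs₀, hs₁, ht₀, ht₁, hu, h1, h2⟩ := hw
  by_contra ha
  exact Roy2001_prop3_holds y α hα s₀ s₁ t₀ t₁ u hs₀ hs₁ ht₀ ht₁ hu h1 h2 ha hb

/-- Roy 2001, §5, 1° replayed on Theorem 1's window: Schanuel for rank `l` gives the wide-window
criterion for rank `l`. [cite: Roy2001, §5 (1°)] -/
theorem cruxWideWindow_rank_of_schanuelRank {l : ℕ} (hS : SchanuelRank l) :
    ∀ (y α : Fin l → ℂ), LinearIndependent ℚ y → (∀ j, α j ≠ 0) →
      ∀ (s₀ s₁ t₀ t₁ u : ℝ), RoyThm1Window s₀ s₁ t₀ t₁ u → RoyHypothesis y α s₀ s₁ t₀ t₁ u →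
        (l : Cardinal) ≤ Algebra.trdeg ℚ ↥(IntermediateField.adjoin ℚ (Set.range y ∪ Set.range α)) := by
  intro y α hy hα s₀ s₁ t₀ t₁ u hw hhyp
  have hd : ∀ j, RoyConditionA (y j) (α j) := fun j =>
    condA_of_condB_wide (hα j) hw (royConditionB_of_royHypothesis hhyp j)
  choose d hd1 hd2 using hd
  set D : ℕ := ∏ j, d j with hD
  have hD0 : 0 < D := Finset.prod_pos fun j _ => hd1 j
  have hαD : ∀ j, α j ^ D = cexp (D * y j) := by
    intro j
    obtain ⟨e, he⟩ : d j ∣ D := Finset.dvd_prod_of_mem _ (Finset.mem_univ j)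
    rw [he, pow_mul, hd2 j, ← Complex.exp_nat_mul]
    push_cast; ring_nf
  set y' : Fin l → ℂ := fun j => (D : ℂ) * y j with hy'_def
  have hy' : LinearIndependent ℚ y' := by
    have hDq : (D : ℚ) ≠ 0 := by exact_mod_cast hD0.ne'
    have := hy.units_smul (fun _ => Units.mk0 (D : ℚ) hDq)
    convert this using 1
    ext j
    simp [hy'_def, Units.smul_def, Rat.smul_def]
  have hle : IntermediateField.adjoin ℚ (Set.range y' ∪ Set.range (cexp ∘ y')) ≤
      IntermediateField.adjoin ℚ (Set.range y ∪ Set.range α) := by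
    refine IntermediateField.adjoin_le_iff.mpr ?_
    rintro x (⟨j, rfl⟩ | ⟨j, rfl⟩)
    · exact mul_mem (natCast_mem _ D)
        (IntermediateField.subset_adjoin _ _ (Or.inl ⟨j, rfl⟩))
    · change cexp ((D : ℂ) * y j) ∈ _
      rw [← hαD j]
      exact pow_mem (IntermediateField.subset_adjoin ℚ (Set.range y ∪ Set.range α)
        (Or.inr ⟨j, rfl⟩)) D
  calc (l : Cardinal)
      ≤ Algebra.trdeg ℚ ↥(IntermediateField.adjoin ℚ (Set.range y' ∪ Set.range (cexp ∘ y'))) :=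
        hS y' hy'
    _ ≤ Algebra.trdeg ℚ ↥(IntermediateField.adjoin ℚ (Set.range y ∪ Set.range α)) :=
        trdeg_le_of_injective (IntermediateField.inclusion hle)
          (IntermediateField.inclusion_injective hle)

/-- **The excess `u`-inequalities of (1) carry no truth content**: the crux on Theorem 1's wider
window (`u` unbounded above, `u > min(s₀, 2s₁)` only) is STILL equivalent to Schanuel's conjecture.
They serve the CONVERSE (`royHypothesis_exp'`, i.e. Thm. 3, needs `u < (1+t₀+t₁)/2`): they make
Conjecture 2 necessary, not sufficient, for Schanuel. [cite: Roy2001, Thm. 1 and §5] -/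
theorem cruxWideWindow_iff_schanuel : CruxWideWindow ↔ _root_.Schanuel := by
  constructor
  · intro h n
    exact (Roy2001_iff_holds n).mp (crux_of_cruxWideWindow h n)
  · intro h n
    exact cruxWideWindow_rank_of_schanuelRank (h n)

/-- … hence equivalent to the crux itself. -/
theorem cruxWideWindow_iff_crux : CruxWideWindow ↔ RoyThesis :=
  cruxWideWindow_iff_schanuel.trans crux_iff_schanuel.symm

/-! ## §3 Tightness, non-vacuity, and rank one -/

/-- The crux with the conclusion strengthened by one: `trdeg ≥ n + 1`. -/
def CruxSucc : Prop :=
  ∀ (n : ℕ) (y α : Fin n → ℂ), LinearIndependent ℚ y → (∀ j, α j ≠ 0) →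
    ∀ (s₀ s₁ t₀ t₁ u : ℝ), RoyAdmissible s₀ s₁ t₀ t₁ u → RoyHypothesis y α s₀ s₁ t₀ t₁ u →
      ((n + 1 : ℕ) : Cardinal) ≤ Algebra.trdeg ℚ ↥(IntermediateField.adjoin ℚ (Set.range y ∪ Set.range α))

/-- **TIGHTNESS — the exponent `n` of the conclusion cannot be improved**: `(y, α) = (1, e)` is
linearly independent with units, satisfies the hypothesis (`royHypothesis_exp'`), and
`trdeg ℚ(1, e) ≤ 1 < 2`. -/
theorem not_cruxSucc : ¬ CruxSucc := by
  intro h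
  have hhyp := royHypothesis_exp' (![1] : Fin 1 → ℂ) royAdmissible_example
  have h2 := h 1 ![1] (cexp ∘ ![1]) linearIndependent_one (fun j => Complex.exp_ne_zero _)
    _ _ _ _ _ royAdmissible_example hhyp
  have hle : Algebra.trdeg ℚ ↥(IntermediateField.adjoin ℚ
      (Set.range (![1] : Fin 1 → ℂ) ∪ Set.range (cexp ∘ ![1]))) ≤ 1 := by
    refine trdeg_adjoin_le_one_of_subset (cexp 1) ?_
    rintro x (⟨j, rfl⟩ | ⟨j, rfl⟩)
    · have : (![(1 : ℂ)] j) = 1 := by fin_cases j; rfl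
      rw [this]; exact one_mem _
    · have : (cexp ∘ ![(1 : ℂ)]) j = cexp 1 := by fin_cases j; rfl
      rw [this]; exact IntermediateField.mem_adjoin_simple_self ℚ _
  have := h2.trans hle
  norm_num at this

/-- **NON-VACUITY (all ranks)**: on the graph of `exp` the hypothesis holds for every `y` and every
admissible tuple (`royHypothesis_exp'`: Siegel's lemma on the `D`-Taylor coefficients at `0` +
Schwarz, in tree). [cite: Roy2001, §5 (2°)] -/
theorem royHypothesis_on_graph {l : ℕ} (y : Fin l → ℂ) {s₀ s₁ t₀ t₁ u : ℝ}
    (hadm : RoyAdmissible s₀ s₁ t₀ t₁ u) : RoyHypothesis y (cexp ∘ y) s₀ s₁ t₀ t₁ u :=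
  royHypothesis_exp' y hadm

/-- In rank one Roy's hypothesis IS condition (b) of Theorem 1. [cite: Roy2001, §5 (1°)] -/
theorem royHypothesis_one_iff (y α : ℂ) (s₀ s₁ t₀ t₁ u : ℝ) :
    RoyHypothesis (![y] : Fin 1 → ℂ) ![α] s₀ s₁ t₀ t₁ u ↔ RoyConditionB y α s₀ s₁ t₀ t₁ u := by
  constructor
  · intro h
    simpa using royConditionB_of_royHypothesis h 0
  · intro h
    refine h.mono fun N hN => ?_
    obtain ⟨P, hP0, hd0, hd1, hH, hval⟩ := hN
    refine ⟨P, hP0, hd0, hd1, hH, fun k m hk hm => ?_⟩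
    have hpt : (![∑ j, (m j : ℂ) * (![y] : Fin 1 → ℂ) j, ∏ j, (![α] : Fin 1 → ℂ) j ^ m j] : Fin 2 → ℂ) =
        ![(m 0 : ℂ) * y, α ^ m 0] := by simp
    rw [hpt]
    exact hval k (m 0) hk (hm 0)

/-- **RANK ONE DECIDED (Roy 2001, Thm. 1, both directions proved in tree)**: for `α ≠ 0` and
admissible parameters, Roy's hypothesis for `(y, α)` holds IFF `α^d = e^{dy}` for some `d ≥ 1` — the
hypothesis is satisfied exactly on the torsion translates of the graph of `exp`. So no rank-one datum
is a counterexample (Hermite–Lindemann), and every counterexample to the crux has rank `≥ 2`.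
[cite: Roy2001, Thm. 1] -/
theorem rankOne_decided {y α : ℂ} (hα : α ≠ 0) {s₀ s₁ t₀ t₁ u : ℝ} (hadm : RoyAdmissible s₀ s₁ t₀ t₁ u) :
    RoyHypothesis (![y] : Fin 1 → ℂ) ![α] s₀ s₁ t₀ t₁ u ↔ ∃ d : ℕ, 1 ≤ d ∧ α ^ d = cexp (d * y) :=
  (royHypothesis_one_iff y α s₀ s₁ t₀ t₁ u).trans (Roy2001_thm1_holds y α hα s₀ s₁ t₀ t₁ u hadm).symm

/-! ## §4 Natural strengthenings / variants refuted -/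

/-! ### (c1) Multiplicity is load-bearing: values without derivatives are cheap -/

/-- Roy's hypothesis with the derivatives DELETED (`k = 0` only; `s₀` disappears). -/
def RoyHypothesisNoDeriv {l : ℕ} (y α : Fin l → ℂ) (s₁ t₀ t₁ u : ℝ) : Prop :=
  ∀ᶠ N : ℕ in atTop, ∃ P : MvPolynomial (Fin 2) ℤ, P ≠ 0 ∧
    (P.degreeOf 0 : ℝ) ≤ (N : ℝ) ^ t₀ ∧ (P.degreeOf 1 : ℝ) ≤ (N : ℝ) ^ t₁ ∧
    (mvPolyHeight P : ℝ) ≤ Real.exp N ∧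
    ∀ (m : Fin l → ℕ), (∀ j, (m j : ℝ) ≤ (N : ℝ) ^ s₁) →
      ‖aeval ![∑ j, (m j : ℂ) * y j, ∏ j, α j ^ m j] P‖ ≤ Real.exp (-(N : ℝ) ^ u)

/-- **Without derivatives the hypothesis holds at `(1, 1)` with `P_N = X₁ − 1`** (degree `1`,
height `1`, exact zeros at every `(m, 1)`), for ALL `t₁ ≥ 0` and all `s₁, t₀, u`. -/
theorem royHypothesisNoDeriv_one_one {s₁ t₀ t₁ u : ℝ} (ht₁ : 0 ≤ t₁) :
    RoyHypothesisNoDeriv (![1] : Fin 1 → ℂ) ![1] s₁ t₀ t₁ u := by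
  filter_upwards [eventually_ge_atTop 1] with N hN
  have hN1 : (1 : ℝ) ≤ N := by exact_mod_cast hN
  refine ⟨X 1 - 1, X_one_sub_one_ne_zero, ?_, ?_, ?_, fun m _ => ?_⟩
  · rw [degreeOf_zero_X_one_sub_one]; simpa using Real.rpow_nonneg (Nat.cast_nonneg N) t₀
  · calc (((X 1 - 1 : MvPolynomial (Fin 2) ℤ)).degreeOf 1 : ℝ) ≤ 1 := by
          exact_mod_cast degreeOf_one_X_one_sub_one
      _ ≤ (N : ℝ) ^ t₁ := Real.one_le_rpow hN1 ht₁
  · calc ((mvPolyHeight (X 1 - 1 : MvPolynomial (Fin 2) ℤ) : ℕ) : ℝ) ≤ 1 := by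
          exact_mod_cast mvPolyHeight_X_one_sub_one_le
      _ ≤ Real.exp N := by have := Real.add_one_le_exp (N : ℝ); linarith
  · rw [point_one, one_pow]
    simp [(Real.exp_pos _).le]

/-- The crux with derivatives deleted from the hypothesis (everything else verbatim). -/
def CruxNoDeriv : Prop :=
  ∀ (n : ℕ) (y α : Fin n → ℂ), LinearIndependent ℚ y → (∀ j, α j ≠ 0) →
    ∀ (s₀ s₁ t₀ t₁ u : ℝ), RoyAdmissible s₀ s₁ t₀ t₁ u → RoyHypothesisNoDeriv y α s₁ t₀ t₁ u →
      (n : Cardinal) ≤ Algebra.trdeg ℚ ↥(IntermediateField.adjoin ℚ (Set.range y ∪ Set.range α))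

/-- **STRENGTHENING REFUTED — no multiplicity**: small VALUES alone (no `D`-derivatives) at the
translates do not force degeneracy: `(1, 1)`, `P_N = X₁ − 1`, Roy's example parameters. So every
proof must use the derivatives `D^k`, `k ≤ N^{s₀}` (`s₀ > 1`). -/
theorem not_cruxNoDeriv : ¬ CruxNoDeriv := fun h =>
  not_one_le_trdeg_one isIntegral_one (h 1 ![1] ![1] linearIndependent_one (fun j => by simp)
    _ _ _ _ _ royAdmissible_example (royHypothesisNoDeriv_one_one (by norm_num)))

/-! ### (c2) The multiplicative part `X₁ ∂/∂X₁` of `D` is load-bearing -/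

/-- Roy's hypothesis with `D = ∂₀ + X₁∂₁` replaced by the ADDITIVE derivation `∂/∂X₀` alone. -/
def RoyHypothesisPartial0 {l : ℕ} (y α : Fin l → ℂ) (s₀ s₁ t₀ t₁ u : ℝ) : Prop :=
  ∀ᶠ N : ℕ in atTop, ∃ P : MvPolynomial (Fin 2) ℤ, P ≠ 0 ∧
    (P.degreeOf 0 : ℝ) ≤ (N : ℝ) ^ t₀ ∧ (P.degreeOf 1 : ℝ) ≤ (N : ℝ) ^ t₁ ∧
    (mvPolyHeight P : ℝ) ≤ Real.exp N ∧
    ∀ (k : ℕ) (m : Fin l → ℕ), (k : ℝ) ≤ (N : ℝ) ^ s₀ → (∀ j, (m j : ℝ) ≤ (N : ℝ) ^ s₁) →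
      ‖aeval ![∑ j, (m j : ℂ) * y j, ∏ j, α j ^ m j] ((pderiv 0)^[k] P)‖ ≤ Real.exp (-(N : ℝ) ^ u)

/-- `∂₀^k (X₁ − 1)` is `X₁ − 1` for `k = 0` and `0` for `k ≥ 1`. -/
theorem iterate_pderiv_zero_X_one_sub_one (k : ℕ) :
    (pderiv 0)^[k] (X 1 - 1 : MvPolynomial (Fin 2) ℤ) = if k = 0 then X 1 - 1 else 0 := by
  cases k with
  | zero => simp
  | succ k =>
    rw [Function.iterate_succ_apply]
    have h1 : pderiv 0 (X 1 - 1 : MvPolynomial (Fin 2) ℤ) = 0 := by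
      rw [map_sub, pderiv_X]; simp
    rw [h1, Function.iterate_fixed (map_zero _) k]
    simp

/-- With `∂/∂X₀` in place of `D` the hypothesis holds at `(1, 1)` with `P_N = X₁ − 1`. -/
theorem royHypothesisPartial0_one_one {s₀ s₁ t₀ t₁ u : ℝ} (ht₁ : 0 ≤ t₁) :
    RoyHypothesisPartial0 (![1] : Fin 1 → ℂ) ![1] s₀ s₁ t₀ t₁ u := by
  filter_upwards [eventually_ge_atTop 1] with N hN
  have hN1 : (1 : ℝ) ≤ N := by exact_mod_cast hN
  refine ⟨X 1 - 1, X_one_sub_one_ne_zero, ?_, ?_, ?_, fun k m _ _ => ?_⟩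
  · rw [degreeOf_zero_X_one_sub_one]; simpa using Real.rpow_nonneg (Nat.cast_nonneg N) t₀
  · calc (((X 1 - 1 : MvPolynomial (Fin 2) ℤ)).degreeOf 1 : ℝ) ≤ 1 := by
          exact_mod_cast degreeOf_one_X_one_sub_one
      _ ≤ (N : ℝ) ^ t₁ := Real.one_le_rpow hN1 ht₁
  · calc ((mvPolyHeight (X 1 - 1 : MvPolynomial (Fin 2) ℤ) : ℕ) : ℝ) ≤ 1 := by
          exact_mod_cast mvPolyHeight_X_one_sub_one_le
      _ ≤ Real.exp N := by have := Real.add_one_le_exp (N : ℝ); linarith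
  · rw [point_one, one_pow, iterate_pderiv_zero_X_one_sub_one]
    split_ifs <;> simp [(Real.exp_pos _).le]

/-- The crux with `∂/∂X₀` in place of Roy's `D`. -/
def CruxPartial0 : Prop :=
  ∀ (n : ℕ) (y α : Fin n → ℂ), LinearIndependent ℚ y → (∀ j, α j ≠ 0) →
    ∀ (s₀ s₁ t₀ t₁ u : ℝ), RoyAdmissible s₀ s₁ t₀ t₁ u → RoyHypothesisPartial0 y α s₀ s₁ t₀ t₁ u →
      (n : Cardinal) ≤ Algebra.trdeg ℚ ↥(IntermediateField.adjoin ℚ (Set.range y ∪ Set.range α))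

/-- **VARIANT REFUTED — additive derivatives only**: with `∂/∂X₀` (the invariant derivation of
`𝔾ₐ` alone) in place of `D = ∂₀ + X₁∂₁` (the invariant derivation of `𝔾ₐ × 𝔾ₘ` along the diagonal
one-parameter subgroup `t ↦ (t, e^t)`), the criterion is false at `(1, 1)` with `P_N = X₁ − 1`: the
`𝔾ₘ`-component of `D` is what sees the multiplicative coordinate. -/
theorem not_cruxPartial0 : ¬ CruxPartial0 := fun h =>
  not_one_le_trdeg_one isIntegral_one (h 1 ![1] ![1] linearIndependent_one (fun j => by simp)
    _ _ _ _ _ royAdmissible_example (royHypothesisPartial0_one_one (by norm_num)))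

/-! ### (c3) The `∃ᶠ`-variant (hypothesis for infinitely many `N` only) — not settled -/

/-- Roy's hypothesis required only for INFINITELY MANY `N` (`∃ᶠ` in place of `∀ᶠ`). -/
def RoyHypothesisFrequently {l : ℕ} (y α : Fin l → ℂ) (s₀ s₁ t₀ t₁ u : ℝ) : Prop :=
  ∃ᶠ N : ℕ in atTop, ∃ P : MvPolynomial (Fin 2) ℤ, P ≠ 0 ∧
    (P.degreeOf 0 : ℝ) ≤ (N : ℝ) ^ t₀ ∧ (P.degreeOf 1 : ℝ) ≤ (N : ℝ) ^ t₁ ∧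
    (mvPolyHeight P : ℝ) ≤ Real.exp N ∧
    ∀ (k : ℕ) (m : Fin l → ℕ), (k : ℝ) ≤ (N : ℝ) ^ s₀ → (∀ j, (m j : ℝ) ≤ (N : ℝ) ^ s₁) →
      ‖aeval ![∑ j, (m j : ℂ) * y j, ∏ j, α j ^ m j] (royD^[k] P)‖ ≤ Real.exp (-(N : ℝ) ^ u)

/-- The crux with the `∃ᶠ`-hypothesis (a STRONGER statement: weaker hypothesis, same conclusion). -/
def CruxFrequently : Prop :=
  ∀ (n : ℕ) (y α : Fin n → ℂ), LinearIndependent ℚ y → (∀ j, α j ≠ 0) →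
    ∀ (s₀ s₁ t₀ t₁ u : ℝ), RoyAdmissible s₀ s₁ t₀ t₁ u → RoyHypothesisFrequently y α s₀ s₁ t₀ t₁ u →
      (n : Cardinal) ≤ Algebra.trdeg ℚ ↥(IntermediateField.adjoin ℚ (Set.range y ∪ Set.range α))

/-- The `∃ᶠ`-variant implies the crux. NOT REFUTED, and not provably equivalent with what the tree
has: Roy's Prop. 3 (`(b) ⇒ (a)`) consumes the hypothesis at a level `M ≈ N^{1/(t₁+1)}` dictated by
the Dirichlet level `N` of Lemma 4 for `a = arg(α e^{−y})/2π`, so with `∃ᶠ` the two sets of good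
levels need not meet; a finite irrationality measure for `a` (true for algebraic data by Baker-type
bounds, absent from the tree) would restore the argument at every level. The would-be rank-one
counterexamples are `y ∈ iℝ ∩ ℚ̄ ∖ {0}`, `|α| = 1` algebraic (e.g. `(i, 1)`), the only case where
Prop. 3 needs Lemma 4 at all (`|α e^{−y}| ≠ 1` uses no Diophantine input). -/
theorem crux_of_cruxFrequently (h : CruxFrequently) : RoyThesis :=
  fun n y α hy hα s₀ s₁ t₀ t₁ u hadm hhyp => h n y α hy hα s₀ s₁ t₀ t₁ u hadm hhyp.frequently

/-! ## §5 A structural constraint: exact vanishing at the origin -/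

/-- Values of integer polynomials at the integer point `(0, 1)` are integers: a value of norm `< 1`
there is `0`. [folklore] -/
theorem aeval_origin_eq_zero_of_norm_lt_one (Q : MvPolynomial (Fin 2) ℤ)
    (h : ‖aeval ![(0 : ℂ), 1] Q‖ < 1) : aeval ![(0 : ℂ), 1] Q = 0 := by
  have hpt : (fun i => ((![0, 1] : Fin 2 → ℤ) i : ℂ)) = ![(0 : ℂ), 1] := by
    funext i; fin_cases i <;> simp
  have hcast : ((MvPolynomial.eval ![0, 1] Q : ℤ) : ℂ) = aeval ![(0 : ℂ), 1] Q := by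
    rw [intCast_eval, hpt]
  rw [← hcast] at h ⊢
  have hz : |(MvPolynomial.eval ![0, 1] Q : ℤ)| < 1 := by
    have : (|((MvPolynomial.eval ![0, 1] Q : ℤ) : ℝ)|) < 1 := by
      simpa [Complex.norm_intCast] using h
    exact_mod_cast this
  rw [Int.abs_lt_one_iff.mp hz]
  simp

/-- **Every datum satisfies an exact Thue–Siegel condition at the origin**: the translate `m = 0` is
the point `(0, 1) = (0, e^0)` for ALL `(y, α)`, and `D^k P_N(0,1) ∈ ℤ`; so Roy's hypothesis forces
`D^k P_N(0, 1) = 0` for all `k ≤ N^{s₀}`, i.e. `t ↦ P_N(t, e^t)` vanishes at `0` to order `> N^{s₀}`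
(`iteratedDeriv_expEval`). [folklore] -/
theorem royHypothesis_exact_at_origin {l : ℕ} {y α : Fin l → ℂ} {s₀ s₁ t₀ t₁ u : ℝ}
    (h : RoyHypothesis y α s₀ s₁ t₀ t₁ u) :
    ∀ᶠ N : ℕ in atTop, ∃ P : MvPolynomial (Fin 2) ℤ, P ≠ 0 ∧
      (P.degreeOf 0 : ℝ) ≤ (N : ℝ) ^ t₀ ∧ (P.degreeOf 1 : ℝ) ≤ (N : ℝ) ^ t₁ ∧
      (mvPolyHeight P : ℝ) ≤ Real.exp N ∧
      (∀ k : ℕ, (k : ℝ) ≤ (N : ℝ) ^ s₀ → iteratedDeriv k (expEval P) 0 = 0) ∧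
      ∀ (k : ℕ) (m : Fin l → ℕ), (k : ℝ) ≤ (N : ℝ) ^ s₀ → (∀ j, (m j : ℝ) ≤ (N : ℝ) ^ s₁) →
        ‖aeval ![∑ j, (m j : ℂ) * y j, ∏ j, α j ^ m j] (royD^[k] P)‖ ≤ Real.exp (-(N : ℝ) ^ u) := by
  filter_upwards [h, eventually_ge_atTop 1] with N hN hN1
  obtain ⟨P, hP0, hd0, hd1, hH, hval⟩ := hN
  refine ⟨P, hP0, hd0, hd1, hH, fun k hk => ?_, hval⟩
  have h0 := hval k 0 hk (fun j => by simpa using Real.rpow_nonneg (Nat.cast_nonneg N) s₁)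
  have hpt : (![∑ j, ((0 : Fin l → ℕ) j : ℂ) * y j, ∏ j, α j ^ (0 : Fin l → ℕ) j] : Fin 2 → ℂ) =
      ![(0 : ℂ), 1] := by simp
  rw [hpt] at h0
  have hlt : Real.exp (-(N : ℝ) ^ u) < 1 := by
    rw [← Real.exp_zero]
    refine Real.exp_lt_exp.2 ?_
    have : (0 : ℝ) < (N : ℝ) ^ u := Real.rpow_pos_of_pos (by exact_mod_cast hN1) _
    linarith
  rw [iteratedDeriv_expEval, expEval_apply, Complex.exp_zero]
  exact aeval_origin_eq_zero_of_norm_lt_one _ (h0.trans_lt hlt)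

/-! ## -- Targets

None: payload `stuck_stubs = []` (no line picked, no lead HANDOFF yet). -/

/-! ## -- Near-misses

None requiring `sorry`. The one unsettled variant is `CruxFrequently` (§4 (c3)), whose rank-one case
needs an irrationality-measure input the tree lacks; it is not a target of this seat. -/

end Summit.Schanuel.Schanuel.Cruxes.RoyThesis.Disproof

end
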